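import Literature.AnabelianGeometry.EtaleTheta.ThetaCoversLampModelDefs
import Literature.AnabelianGeometry.EtaleTheta.ThetaCoversHeisenbergWitnessProp22
import Literature.AnabelianGeometry.EtaleTheta.ThetaCoversTemperedModelDefs
import Literature.AnabelianGeometry.EtaleTheta.Discharge.Sec2TemperedCoverDataModel
import Literature.AnabelianGeometry.EtaleTheta.Discharge.Sec2TemperedCoverDataModelHeis
import Literature.AnabelianGeometry.EtaleTheta.Discharge.Sec2TwistedModelTheta

/-!
# The lamplighter model of `ThetaCovers.TemperedCoverData` ([EtTh] §2), part 2 (DEF-BEARING): the profinite cover data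
# `CoverDataAx` and the `(1, l-torsΘ)±` datum of Def. 2.3, PULLED BACK from the Heisenberg toy along `Φ = fst : A × Q̂ → heisPiC l`;
# the tempered carrier `Π^tp_C := A × Q₀ → Π_C := A × Q̂`

S. Mochizuki, *The étale theta function …*, Publ. RIMS **45** (2009) [MochizukiEtTh2009], §2: Def. 2.1 (p. 36), Prop. 2.2 (p. 37),
Def. 2.3 (p. 38), Def. 2.5 (p. 39) [cite: MochizukiEtTh2009, Def 2.1 p.36].  abc-iut cell, block F, seat abc-iut-f-142 (row F-0606,
INSTANCE form).  Pattern of abc-iut-w5-d118's `TemperedModel.coverDataAxH` (`ThetaCoversTemperedModelHeis.lean`): every axiom of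
Def. 2.1 / Rmk. 2.1.1 / Prop. 2.2 (i) is the toy's (`heisenbergWitness`, abc-iut-w5-d243) read through the continuous surjection
`Φ`, with `G_K := 1`, `Π_X := Φ⁻¹(heisPiX)`, `Δ̄_Θ-preimage := Φ⁻¹(heisTheta) =: D_x`, `Ker(Δ_X ↠ Δ̄_X) := Ker Φ = 1 × Q̂`;
the Def. 2.3 datum is `Π_C̲ := Φ⁻¹(heisPiCu)`, `E := Φ⁻¹(heisE)`, `S := Ker Φ`, `ι̲ := (s, 1)`, `Π_C̲̲ := (Ker Φ · E) · ⟨ι̲⟩`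
(the toy's `isTypeLTorsPm_heisPiCu`, `isInversion_s`, `isMinusEigen_heisE`, `isSplitting_bot` pulled back).  Then the tempered
carrier `Gtp := A × Q₀` with `toHat := id × ι` (continuous, injective) and `AX := heisPiX ⊆ A`.

HONEST FRAMING. A DESIGNED consistency witness for OUR typed interface (`G_K = 1`; lamplighter groups, not
fundamental groups of curves): it decides which typed sentences are CONSEQUENCES of the interface and which are not;
nothing of [EtTh] is asserted or denied for genuine tempered fundamental groups; instance-at-a-designed-carrier ≠ the
printed lemma; no side is taken on [IUTchIII] Cor. 3.12 or on any author; nothing here bears on abc. typed ≠ proved.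
-/

noncomputable section

namespace Literature.AnabelianGeometry.EtaleTheta

namespace ThetaCovers

namespace LampModel

section Part_2

open Multiplicative HeisenbergWitness TemperedModel

variable (l : ℕ)

/-! ## 1. The Heisenberg toy pulled back along `Φ = fst : A × Q̂ → heisPiC l` -/

/-- `P := A × Q̂`, the model's `Π_C` (compact, Hausdorff, totally disconnected for `l ≠ 0`). (toy bookkeeping)
[cite: MochizukiEtTh2009, Def 2.1 p.36] -/
abbrev P : Type := A l × Qc

/-- Everything lies in the kernel of `Π_C → G_K = 1`. (toy bookkeeping) [cite: MochizukiEtTh2009, Def 2.1 p.36] -/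
theorem mem_ker_oneP (x : P l) : x ∈ (1 : P l →* PUnit.{1}).ker := by
  rw [MonoidHom.mem_ker, MonoidHom.one_apply]

/-- Preimages under `Φ` are closed. (toy bookkeeping) [cite: MochizukiEtTh2009, Def 2.1 p.36] -/
theorem isClosed_preimage_Φ (U : Set (heisPiC l)) : IsClosed (Φ l ⁻¹' U) :=
  ⟨by rw [← Set.preimage_compl]; exact isOpen_preimage_Φ l _⟩

/-- `Π_X := Φ⁻¹(heisPiX)`. (toy bookkeeping) [cite: MochizukiEtTh2009, Def 2.1 p.36] -/
def PiXL : Subgroup (P l) := (heisPiX l).comap (Φ l)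

/-- `Δ̄_Θ`-preimage `:= Φ⁻¹(heisTheta)` (also the model's `D_x`). (toy bookkeeping) [cite: MochizukiEtTh2009, Def 2.1 p.36] -/
def ThetaL : Subgroup (P l) := (heisTheta l).comap (Φ l)

/-- The `(a, b)`-coordinates `Δ_X ↠ (ℤ/l)²` through `Φ` (the toy's `ellCoords`). (toy bookkeeping)
[cite: MochizukiEtTh2009, Def 2.1 p.36] -/
def ellCoordsL : ↥(PiXL l ⊓ (1 : P l →* PUnit.{1}).ker) →* Multiplicative (ZMod l × ZMod l) :=
  (ellCoords.{0} l).comp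
    (((Φ l).comp (PiXL l ⊓ (1 : P l →* PUnit.{1}).ker).subtype).codRestrict _ fun g =>
      ⟨g.2.1, mem_ker_one l _⟩)

/-- They are onto. (toy bookkeeping) [cite: MochizukiEtTh2009, Def 2.1 p.36] -/
theorem ellCoordsL_surjective : Function.Surjective (ellCoordsL l) := by
  intro y
  obtain ⟨⟨h, hh⟩, rfl⟩ := ellCoords_surjective l y
  obtain ⟨x, hx⟩ := Φ_surjective l h
  refine ⟨⟨x, ⟨show Φ l x ∈ heisPiX l by rw [hx]; exact hh.1, mem_ker_oneP l x⟩⟩, ?_⟩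
  change ellCoords l ⟨Φ l x, _⟩ = ellCoords l ⟨h, hh⟩
  congr 1
  exact Subtype.ext hx

/-- Their kernel is `Δ̄_Θ-preimage`. (toy bookkeeping) [cite: MochizukiEtTh2009, Def 2.1 p.36] -/
theorem ellCoordsL_ker : (ellCoordsL l).ker = (ThetaL l).subgroupOf _ := by
  ext g
  rw [MonoidHom.mem_ker, Subgroup.mem_subgroupOf]
  change ellCoords l ⟨Φ l g, _⟩ = 1 ↔ Φ l (g : P l) ∈ heisTheta l
  rw [← MonoidHom.mem_ker, ellCoords_ker, Subgroup.mem_subgroupOf]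

/-- `[Δ̄_Θ-preimage : Ker Φ] = l` (`= #heisTheta`). (toy bookkeeping) [cite: MochizukiEtTh2009, Def 2.1 p.36] -/
theorem relIndex_ker_ThetaL : (Φ l).ker.relIndex (ThetaL l) = l := by
  rw [ThetaL, ← MonoidHom.comap_bot, Subgroup.relIndex_comap,
    Subgroup.map_comap_eq_self_of_surjective (Φ_surjective l), Subgroup.relIndex_bot_left, card_heisTheta]

/-- **The model's `CoverDataAx`** ([EtTh] Def. 2.1 / Rmk. 2.1.1 / Prop. 2.2 (i) axioms): abc-iut-w5-d243's Heisenberg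
toy `heisenbergWitness` PULLED BACK along the surjection `Φ = fst : A × Q̂ → heisPiC l` — `G_K := 1`,
`Π_X := Φ⁻¹(heisPiX)`, `Δ̄_Θ-preimage := Φ⁻¹(heisTheta) =: D_x`, `Ker(Δ_X ↠ Δ̄_X) := Ker Φ = 1 × Q̂`; every axiom is the
toy's read through `Φ` (the pattern of abc-iut-w5-d118's `TemperedModel.coverDataAxH`). CONSISTENCY/TOY — not the profinite
fundamental group of a curve. [cite: MochizukiEtTh2009, Def 2.1 p.36] -/
abbrev coverDataAxL (hl : Odd l) : CoverDataAx.{0} l where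
  l_odd := hl
  PiC := P l
  GK := PUnit
  aug := 1
  PiX := PiXL l
  PiX_normal := by
    haveI : (heisPiX l).Normal := MonoidHom.normal_ker _
    exact Subgroup.Normal.comap inferInstance _
  index_PiX := by
    rw [PiXL, Subgroup.index_comap_of_surjective _ (Φ_surjective l), index_heisPiX]
  isOpen_PiX := by
    change IsOpen (Φ l ⁻¹' (heisPiX l : Set (heisPiC l)))
    exact isOpen_preimage_Φ l _
  aug_PiX_surjective := fun _ => ⟨1, Subsingleton.elim _ _⟩
  barKer := (Φ l).ker
  barKer_normal := MonoidHom.normal_ker _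
  isClosed_barKer := by
    have : (((Φ l).ker : Subgroup (P l)) : Set (P l)) = Φ l ⁻¹' {1} := by
      ext x; simp [MonoidHom.mem_ker]
    rw [this]
    exact isClosed_preimage_Φ l _
  barTheta := ThetaL l
  barTheta_normal := (heisTheta_normal l).comap _
  barKer_le_barTheta := fun x hx => by
    change Φ l x ∈ heisTheta l
    rw [(MonoidHom.mem_ker).mp hx]
    exact (heisTheta l).one_mem
  barTheta_le := by
    rw [MonoidHom.ker_one, inf_top_eq]
    exact Subgroup.comap_mono (heisTheta_le_heisPiX l)
  relIndex_barKer := relIndex_ker_ThetaL l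
  ell_rank_two := by
    haveI : (ThetaL l).Normal := (heisTheta_normal l).comap _
    exact ⟨(QuotientGroup.quotientMulEquivOfEq (ellCoordsL_ker l).symm).trans
      (QuotientGroup.quotientKerEquivOfSurjective _ (ellCoordsL_surjective l))⟩
  barTheta_central := by
    intro t ht d hd
    rw [MonoidHom.ker_one, inf_top_eq] at hd
    rw [MonoidHom.mem_ker, map_mul, map_mul, map_mul, map_inv, map_inv]
    exact heis_central l hl ht hd
  Dx := ThetaL l
  Dx_le := Subgroup.comap_mono (heisTheta_le_heisPiX l)
  aug_Dx_surjective := fun _ => ⟨1, Subsingleton.elim _ _⟩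
  inertia_sup_barKer := by
    rw [MonoidHom.ker_one, inf_top_eq]
    refine sup_eq_left.mpr fun x hx => ?_
    change Φ l x ∈ heisTheta l
    rw [(MonoidHom.mem_ker).mp hx]
    exact (heisTheta l).one_mem
  pow_mem_barKer := by
    intro d hd
    rw [MonoidHom.ker_one, inf_top_eq] at hd
    rw [MonoidHom.mem_ker, map_pow]
    exact pow_eq_one l hl hd
  inv_ell := by
    intro c _ hc d hd
    rw [MonoidHom.ker_one, inf_top_eq] at hd
    change Φ l (c * d * c⁻¹ * d) ∈ heisTheta l
    rw [map_mul, map_mul, map_mul, map_inv]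
    exact heis_inv_ell l hl hc hd
  inv_theta := by
    intro c _ hc t ht
    rw [MonoidHom.mem_ker, map_mul, map_mul, map_mul, map_inv, map_inv]
    exact heis_inv_theta l hl hc ht

/-! ## 2. The `(1, l-torsΘ)±` datum of the model (Def. 2.3), pulled back from the toy -/

/-- `Π_C̲ := Φ⁻¹(heisPiCu)`. (toy bookkeeping) [cite: MochizukiEtTh2009, Def 2.1 p.36] -/
def HpL : Subgroup (P l) := (heisPiCu l).comap (Φ l)

/-- `E := Φ⁻¹(heisE)`, the `(−1)`-eigenspace datum pulled back. (toy bookkeeping) [cite: MochizukiEtTh2009, Prop 2.2(i) p.37] -/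
def EL : Subgroup (P l) := (heisE l).comap (Φ l)

/-- The inversion `ι̲ := (s, 1)`. (toy bookkeeping) [cite: MochizukiEtTh2009, Prop 2.2 p.36] -/
def iotaL : P l := ((SemidirectProduct.inr (DihedralGroup.sr 0) : heisPiC l), (1 : Qc))

/-- `Φ(ι̲) = s`. (toy bookkeeping) [cite: MochizukiEtTh2009, Prop 2.2 p.36] -/
theorem Φ_iotaL : Φ l (iotaL l) = SemidirectProduct.inr (DihedralGroup.sr 0) := rfl

/-- `Π_C̲̲ := (Ker Φ · E) · ⟨ι̲⟩` (Def. 2.3). (toy bookkeeping) [cite: MochizukiEtTh2009, Def 2.3 p.38] -/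
def PiCuuL : Subgroup (P l) := (((Φ l).ker ⊔ EL l) ⊔ Subgroup.zpowers (iotaL l))

/-- `Π_C̲ ∩ Π_X = Φ⁻¹(heisPiCu ∩ heisPiX)`. (toy bookkeeping) [cite: MochizukiEtTh2009, Def 2.1 p.36] -/
theorem HpL_inf_PiXL : HpL l ⊓ PiXL l = (heisPiCu l ⊓ heisPiX l).comap (Φ l) := by
  rw [HpL, PiXL, Subgroup.comap_inf]

/-- **`Π_C̲` is of type `(1, l-tors)±`** in the model — the toy's `isTypeLTorsPm_heisPiCu` pulled back along `Φ`.
[cite: MochizukiEtTh2009, Def 2.1 p.36] -/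
theorem isTypeLTorsPm_HpL (hl : Odd l) : (coverDataAxL l hl).toCoverData.IsTypeLTorsPm (HpL l) := by
  have toy := isTypeLTorsPm_heisPiCu l hl
  have tT := toy.inf_isTypeLTors
  obtain ⟨φ₀, hφ₀s, hφ₀k⟩ := tT.quot
  -- the restriction of `Φ` to `Π_X → heisPiX`
  let r : ↥(PiXL l) →* ↥(heisPiX l) := ((Φ l).comp (PiXL l).subtype).codRestrict _ fun g => g.2
  refine ⟨⟨inf_le_right, ⟨φ₀.comp r, ?_, ?_⟩, ?_, ?_, ?_⟩, ?_⟩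
  · intro y
    obtain ⟨⟨h, hh⟩, hy⟩ := hφ₀s y
    obtain ⟨x, hx⟩ := Φ_surjective l h
    refine ⟨⟨x, show Φ l x ∈ heisPiX l by rw [hx]; exact hh⟩, ?_⟩
    rw [← hy, MonoidHom.comp_apply]
    congr 1
    exact Subtype.ext hx
  · intro g
    rw [MonoidHom.comp_apply, hφ₀k, HpL_inf_PiXL]
    rfl
  · change ThetaL l ≤ HpL l ⊓ PiXL l
    rw [HpL_inf_PiXL]
    exact Subgroup.comap_mono tT.barTheta_le
  · change (HpL l ⊓ PiXL l) ⊔ (PiXL l ⊓ (1 : P l →* PUnit.{1}).ker) = PiXL l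
    refine le_antisymm (sup_le inf_le_right inf_le_left) fun x hx => ?_
    exact Subgroup.mem_sup_right ⟨hx, mem_ker_oneP l x⟩
  · change ThetaL l ≤ HpL l ⊓ PiXL l
    rw [HpL_inf_PiXL]
    exact Subgroup.comap_mono tT.Dx_le
  · change (HpL l ⊓ PiXL l).relIndex (HpL l) = 2
    rw [HpL_inf_PiXL, Subgroup.relIndex_comap, HpL,
      Subgroup.map_comap_eq_self_of_surjective (Φ_surjective l)]
    exact toy.relIndex_two

/-- `ι̲` is an inversion for `Π_C̲` (the toy's `isInversion_s` read through `Φ`). [cite: MochizukiEtTh2009, Prop 2.2 p.36] -/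
theorem isInversion_iotaL (hl : Odd l) :
    (coverDataAxL l hl).toCoverData.IsInversion (HpL l) (iotaL l) := by
  have toy := isInversion_s l hl
  exact ⟨toy.mem, mem_ker_oneP l _, toy.not_mem⟩

/-- **`E := Φ⁻¹(heisE)` is the `(−1)`-eigenspace datum `Im(s_ιQ)`** for `(Π_X̲, Π_C̲, ι̲)` in the model — the toy's
`isMinusEigen_heisE` pulled back along the surjection `Φ` (with abc-iut-w5-d118's `TemperedModel.heisE_sup_heisTheta`).
[cite: MochizukiEtTh2009, Prop 2.2(i) p.37] -/
theorem isMinusEigen_EL (hl : Odd l) :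
    (coverDataAxL l hl).toCoverData.IsMinusEigen (HpL l ⊓ PiXL l) (HpL l) (iotaL l) (EL l) := by
  have toy := isMinusEigen_heisE l hl
  have hsnot : (SemidirectProduct.inr (DihedralGroup.sr 0) : heisPiC l) ∉ heisPiX l := fun h => by
    obtain ⟨i, hi⟩ := (mem_heisPiX l).mp h; cases hi
  refine ⟨?_, ?_, ?_, ?_, ?_, ?_, ?_, ?_⟩
  · change (Φ l).ker ≤ (heisE l).comap (Φ l)
    rw [← MonoidHom.comap_bot]
    exact Subgroup.comap_mono bot_le
  · change EL l ≤ (HpL l ⊓ PiXL l) ⊓ (1 : P l →* PUnit.{1}).ker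
    rw [MonoidHom.ker_one, inf_top_eq, HpL_inf_PiXL]
    intro x hx
    exact (mem_heisPiCu_inf l).mpr ((mem_heisE l).mp hx).1
  · intro g hg e he
    change Φ l (g * e * g⁻¹) ∈ heisE l
    rw [map_mul, map_mul, map_inv]
    rw [HpL_inf_PiXL] at hg
    exact toy.conj_mem (Φ l g) hg (Φ l e) he
  · change (heisE l).comap (Φ l) ⊓ (heisTheta l).comap (Φ l) = (Φ l).ker
    rw [← Subgroup.comap_inf, ← MonoidHom.comap_bot]
    exact congrArg (Subgroup.comap (Φ l)) toy.inf_eq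
  · change (heisE l).comap (Φ l) ⊔ (heisTheta l).comap (Φ l) =
      (HpL l ⊓ PiXL l) ⊓ (1 : P l →* PUnit.{1}).ker
    rw [MonoidHom.ker_one, inf_top_eq, Subgroup.comap_sup_eq (Φ l) _ _ (Φ_surjective l),
      heisE_sup_heisTheta l hl, HpL_inf_PiXL]
  · intro e he
    rw [MonoidHom.mem_ker, map_mul, map_mul, map_mul, map_inv, Φ_iotaL]
    exact Subgroup.mem_bot.mp (toy.minus (Φ l e) he)
  · intro t ht
    rw [MonoidHom.mem_ker, map_mul, map_mul, map_mul, map_inv, map_inv, Φ_iotaL]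
    exact heis_inv_theta l hl hsnot ht
  · intro e he
    change Φ l (iotaL l * e * (iotaL l)⁻¹) ∈ heisE l
    rw [map_mul, map_mul, map_inv, Φ_iotaL]
    exact toy.iota_conj (Φ l e) he

/-- `S := Ker Φ` is a splitting of `D̄_x ↠ G_K = 1`. [cite: MochizukiEtTh2009, Prop 2.2(ii) p.37] -/
theorem isSplitting_kerΦ (hl : Odd l) : (coverDataAxL l hl).toCoverData.IsSplitting (Φ l).ker :=
  ⟨le_rfl, le_sup_right, inf_eq_left.mpr (by
      change (Φ l).ker ≤ ThetaL l
      rw [ThetaL, ← MonoidHom.comap_bot]; exact Subgroup.comap_mono bot_le),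
    fun _ => ⟨1, Subsingleton.elim _ _⟩⟩

/-- `ι̲² = 1`. (toy bookkeeping) [cite: MochizukiEtTh2009, Prop 2.2(iii) p.37] -/
theorem iotaL_mul_self : iotaL l * iotaL l = 1 :=
  Prod.ext (TwistedModel.heis_s_mul_s l) (mul_one _)

/-- **`Π_C̲̲` is of type `(1, l-torsΘ)±`** in the model (Def. 2.3 datum, assembled from the pulled-back toy data).
[cite: MochizukiEtTh2009, Def 2.3 p.38] -/
theorem isTypeLTorsThetaPm_PiCuuL (hl : Odd l) :
    (coverDataAxL l hl).toCoverData.IsTypeLTorsThetaPm (PiCuuL l) :=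
  ⟨HpL l, EL l, (Φ l).ker, iotaL l, isTypeLTorsPm_HpL l hl, isInversion_iotaL l hl,
    by rw [iotaL_mul_self]; exact (Φ l).ker.one_mem, isMinusEigen_EL l hl, isSplitting_kerΦ l hl, rfl⟩

/-- `Π_C̲̲` is open (it contains the open `E = Φ⁻¹(heisE)`). (toy bookkeeping) [cite: MochizukiEtTh2009, Def 2.3 p.38] -/
theorem isOpen_PiCuuL : IsOpen (PiCuuL l : Set (P l)) := by
  have hE : IsOpen (EL l : Set (P l)) := by
    change IsOpen (Φ l ⁻¹' (heisE l : Set (heisPiC l)))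
    exact isOpen_preimage_Φ l _
  exact Subgroup.isOpen_mono (le_sup_right.trans le_sup_left) hE

/-- `K ⊇ μ_l` in the model: all of `Π_C` centralises `Δ̄_Θ` modulo `Ker` (the toy's `heisTheta` is central).
(toy bookkeeping) [cite: MochizukiEtTh2009, Rmk 2.6.1 p.40] -/
theorem hasMuL_L (hl : Odd l) (c : P l) {t : P l} (ht : t ∈ ThetaL l) :
    c * t * c⁻¹ * t⁻¹ ∈ (Φ l).ker := by
  rw [MonoidHom.mem_ker, map_mul, map_mul, map_mul, map_inv, map_inv]
  exact heis_theta_central l hl (Φ l c) ht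

/-! ## 3. The tempered carrier `Π^tp_C := A × Q₀` and the completion map -/

/-- `Π^tp_C := A × Q₀` (topological group; NOT compact, NOT discrete). (toy bookkeeping)
[cite: MochizukiEtTh2009, Def 2.5 p.39] -/
abbrev Gtp : Type := A l × Qt

/-- `Π^tp_C → Π_C`, `(a, x) ↦ (a, x̂)`. (toy bookkeeping) [cite: MochizukiEtTh2009, Def 2.5 p.39] -/
def toHatL : Gtp l →* P l := (MonoidHom.id (A l)).prodMap ιQ

/-- [cite: MochizukiEtTh2009, Def 2.5 p.39] -/
@[simp] theorem toHatL_apply (a : A l) (x : Qt) : toHatL l (a, x) = (a, ιQ x) := rfl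

/-- `Π^tp_C → Π_C` is continuous … (toy bookkeeping) [cite: MochizukiEtTh2009, Def 2.5 p.39] -/
theorem continuous_toHatL : Continuous (toHatL l) :=
  continuous_id.prodMap continuous_ιQ

/-- … and injective. (toy bookkeeping) [cite: MochizukiEtTh2009, Def 2.5 p.39] -/
theorem toHatL_injective : Function.Injective (toHatL l) := by
  rintro ⟨a, x⟩ ⟨b, y⟩ h
  simp only [toHatL_apply, Prod.mk.injEq] at h
  rw [h.1, ιQ_injective h.2]

/-- `heisPiX` as a subgroup of the synonym `A`. (toy bookkeeping) [cite: MochizukiEtTh2009, Def 2.1 p.36] -/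
def AX : Subgroup (A l) := (heisPiX l).comap (toHeis l)

/-- Membership in `AX`. (toy bookkeeping) [cite: MochizukiEtTh2009, Def 2.1 p.36] -/
theorem mem_AX {a : A l} : a ∈ AX l ↔ toHeis l a ∈ heisPiX l := Iff.rfl

/-- `AX` is normal. (toy bookkeeping) [cite: MochizukiEtTh2009, Def 2.1 p.36] -/
theorem AX_normal : (AX l).Normal :=
  Subgroup.Normal.comap (MonoidHom.normal_ker _ : (heisPiX l).Normal) (toHeis l)

/-- `Π_X` pulled back to `Π^tp_C` is `heisPiX × Q₀`. (toy bookkeeping) [cite: MochizukiEtTh2009, Def 2.5 p.39] -/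
theorem comap_toHatL_PiXL : (PiXL l).comap (toHatL l) = (AX l).prod ⊤ := by
  ext ⟨a, x⟩
  rw [Subgroup.mem_comap, Subgroup.mem_prod, mem_AX]
  exact ⟨fun h => ⟨h, trivial⟩, fun h => h.1⟩

end Part_2

end LampModel

end ThetaCovers

end Literature.AnabelianGeometry.EtaleTheta
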